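import Mathlib
import Summits.Ventures.PercRepro2.LocRows
import Summits.Ventures.PercRepro2.LocRows2
import Summits.Ventures.PercRepro2.LocSym
import Summits.Ventures.PercRepro2.DownsetBijection

/-!
# Definitions and lemmas for the class-level monotone injection (blind cell PercRepro2, night-4 g2)

The class `cls ζ₀` of a source `ζ₀ ∈ M₀` (same blue cluster `B = C_B(l)(ζ₀)`, same colouring off
`touches B`), the outside red cluster `outsideRed` of `h` (red-connected to `h` without edges touching
`B`), the leak edges (boundary edges of `B` into it), the red edge set `redW` inside `B`, the image
configuration `img` (a given red set inside `B`, red on non-leak boundary edges, blue on leak edges,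
`ζ₀` elsewhere), the endpoint lemmas, and **`isDownset_redW_cls`**: the red sets inside `B` of the
class form a down-set of the cube `2^{within B}`.  The theorem is in `ClassMono.lean`.
-/

namespace Summit.Ventures.PercRepro2

namespace LocRows

open Hull Downset

variable {V : Type*} {E : Type*} [Fintype E] [DecidableEq E]

open scoped Classical

variable (ends : E → Sym2 V)

omit [Fintype E] [DecidableEq E] in
/-- An edge from the blue cluster of `l` to a vertex outside it is red. -/
lemma red_of_mem_cluster_blue_of_notMem' {l : V} {ζ : Config E} {e : E} {x y : V}
    (hx : x ∈ cluster ends (blue ζ) l) (hy : y ∉ cluster ends (blue ζ) l) (hends : ends e = s(x, y)) :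
    ζ e = true := by
  by_contra hred
  have hb : blue ζ e = true := by
    simp [blue, Bool.eq_false_iff.2 hred]
  exact hy (mem_cluster_of_edge hx hb hends)

/-- The class of the source `ζ₀`: the sources with the same blue cluster of `l` and the same colouring
off the edges touching it. -/
noncomputable def cls (l h o : V) (ζ₀ : Config E) : Finset (Config E) :=
  (srcU ends l h {S : Set V | o ∈ S}).filter fun ζ =>
    cluster ends (blue ζ) l = cluster ends (blue ζ₀) l ∧
      ∀ e, e ∉ touches ends (cluster ends (blue ζ₀) l) → ζ e = ζ₀ e

/-- The outside red cluster of `h`: red-connected to `h` without any edge touching `B`. -/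
noncomputable def outsideRed (B : Set V) (ζ₀ : Config E) (h : V) : Set V :=
  cluster ends (delConfig ends B ζ₀) h

/-- The leak edges: boundary edges of `B` into the outside red cluster of `h`. -/
def leak (B Yh : Set V) : Set E := {e | ∃ x ∈ B, ∃ y ∈ Yh, ends e = s(x, y)}

/-- The red edges inside `B` of a configuration, as a finset. -/
noncomputable def redW (B : Set V) (ζ : Config E) : Finset E :=
  Finset.univ.filter fun e => e ∈ within ends B ∧ ζ e = true

/-- The image configuration: `D` inside `B`, red on the non-leak boundary edges, blue on the leak
edges, `ζ₀` elsewhere. -/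
noncomputable def img (B Yh : Set V) (ζ₀ : Config E) (D : Finset E) : Config E :=
  fun e => if e ∈ within ends B then decide (e ∈ D)
    else if e ∈ touches ends B then decide (e ∉ leak ends B Yh) else ζ₀ e

section Class

variable {l h o : V} {ζ₀ : Config E}

omit [Fintype E] [DecidableEq E] in
/-- Unpacking `mem_touches` along the endpoints. -/
lemma endpoints_mem_of_touches {B : Set V} {e : E} {x y : V} (hends : ends e = s(x, y))
    (he : e ∈ touches ends B) : x ∈ B ∨ y ∈ B := by
  obtain ⟨x', hx', y', h'⟩ := he
  rw [hends, Sym2.eq_iff] at h'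
  rcases h' with ⟨rfl, rfl⟩ | ⟨rfl, rfl⟩
  · exact Or.inl hx'
  · exact Or.inr hx'

omit [Fintype E] [DecidableEq E] in
/-- An edge with both endpoints in `B` lies inside `B`. -/
lemma mem_within_of_ends {B : Set V} {e : E} {x y : V} (hends : ends e = s(x, y)) (hx : x ∈ B)
    (hy : y ∈ B) : e ∈ within ends B := ⟨x, hx, y, hy, hends⟩

omit [Fintype E] [DecidableEq E] in
/-- Unpacking `mem_within` along the endpoints. -/
lemma endpoints_of_within {B : Set V} {e : E} {x y : V} (hends : ends e = s(x, y))
    (he : e ∈ within ends B) : x ∈ B ∧ y ∈ B := by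
  obtain ⟨x', hx', y', hy', h'⟩ := he
  rw [hends, Sym2.eq_iff] at h'
  rcases h' with ⟨rfl, rfl⟩ | ⟨rfl, rfl⟩
  · exact ⟨hx', hy'⟩
  · exact ⟨hy', hx'⟩

omit [Fintype E] [DecidableEq E] in
/-- Unpacking a leak edge along the endpoints. -/
lemma leak_endpoints {B Yh : Set V} {e : E} {x y : V} (hends : ends e = s(x, y))
    (he : e ∈ leak ends B Yh) : (x ∈ B ∧ y ∈ Yh) ∨ (y ∈ B ∧ x ∈ Yh) := by
  obtain ⟨x', hx', y', hy', h'⟩ := he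
  rw [hends, Sym2.eq_iff] at h'
  rcases h' with ⟨rfl, rfl⟩ | ⟨rfl, rfl⟩
  · exact Or.inl ⟨hx', hy'⟩
  · exact Or.inr ⟨hx', hy'⟩

/-- Membership in the class. -/
lemma mem_cls {ζ : Config E} :
    ζ ∈ cls ends l h o ζ₀ ↔ ζ ∈ srcU ends l h {S : Set V | o ∈ S} ∧
      cluster ends (blue ζ) l = cluster ends (blue ζ₀) l ∧
      ∀ e, e ∉ touches ends (cluster ends (blue ζ₀) l) → ζ e = ζ₀ e := by
  simp [cls]

/-- Membership in the source set, unpacked. -/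
lemma mem_srcU_iff {ζ : Config E} :
    ζ ∈ srcU ends l h {S : Set V | o ∈ S} ↔
      h ∉ hull ends ζ l ∧ o ∈ cluster ends (blue ζ) l ∧ o ∉ cluster ends ζ l := by
  simp [srcU]

/-- Membership in the target set, unpacked. -/
lemma mem_tgtU_iff {ζ : Config E} :
    ζ ∈ tgtU ends l h {S : Set V | o ∈ S} ↔
      h ∉ hull ends ζ l ∧ o ∈ cluster ends ζ l ∧ o ∉ cluster ends (blue ζ) l := by
  simp [tgtU]

omit [Fintype E] [DecidableEq E] in
/-- `B` does not meet the outside red cluster of `h` (when `h ∉ B`): the edges touching `B` are deleted. -/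
lemma outsideRed_disjoint {B : Set V} (hh : h ∉ B) {x : V} (hx : x ∈ B) :
    x ∉ outsideRed ends B ζ₀ h := by
  intro hmem
  -- the complement of `B` is closed under open adjacency in `delConfig`
  have hclosed : ∀ a ∈ (Bᶜ : Set V), ∀ b, (openGraph ends (delConfig ends B ζ₀)).Adj a b → b ∈ (Bᶜ : Set V) := by
    intro a ha b hab
    obtain ⟨_, e, he, hends⟩ := exists_edge_of_adj hab
    intro hb
    have ht : e ∈ touches ends B := mem_touches_of_ends hends (Or.inr hb)
    rw [delConfig_apply_of_mem ht] at he
    exact Bool.false_ne_true he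
  exact (mem_of_conn_of_closed hclosed (v := h) hh hmem) hx

omit [Fintype E] [DecidableEq E] in
/-- `delConfig` is below every configuration agreeing with `ζ₀` off `touches B`. -/
lemma delConfig_le_of_eq_off {B : Set V} {ζ : Config E}
    (hζ : ∀ e, e ∉ touches ends B → ζ e = ζ₀ e) : delConfig ends B ζ₀ ≤ ζ := by
  intro e
  by_cases ht : e ∈ touches ends B
  · rw [delConfig_apply_of_mem ht]; exact Bool.false_le _
  · rw [delConfig_apply_of_notMem ht, hζ e ht]

/-- The red sets inside `B` of the class form a down-set. -/
lemma isDownset_redW_cls :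
    IsDownset ((cls ends l h o ζ₀).image (redW ends (cluster ends (blue ζ₀) l))) := by
  set B := cluster ends (blue ζ₀) l with hB
  intro c hc c' hc'
  rw [Finset.mem_image] at hc
  obtain ⟨ζ, hζ, rfl⟩ := hc
  rw [mem_cls, mem_srcU_iff] at hζ
  obtain ⟨⟨hhull, hoB, hoR⟩, hBζ, hoff⟩ := hζ
  rw [← hB] at hBζ hoff
  have hlB : l ∈ B := mem_cluster_self ends (blue ζ₀) l
  -- the smaller configuration
  set ζ' : Config E := fun e => if e ∈ within ends B then decide (e ∈ c') else ζ e with hζ'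
  have hle : ζ' ≤ ζ := by
    intro e
    by_cases hw : e ∈ within ends B
    · simp only [hζ', hw, if_true]
      by_cases hc'e : e ∈ c'
      · have : e ∈ redW ends B ζ := hc' hc'e
        simp only [redW, Finset.mem_filter, Finset.mem_univ, true_and] at this
        rw [this.2]; simp
      · simp [hc'e]
    · simp [hζ', hw]
  have hble : blue ζ ≤ blue ζ' := by
    intro e
    have := hle e
    simp only [blue]
    revert this
    cases ζ e <;> cases ζ' e <;> simp
  -- the blue cluster of `ζ'` is `B`
  have hBζ' : cluster ends (blue ζ') l = B := by
    apply le_antisymm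
    · -- `B` is closed under blue adjacency of `ζ'`
      have hclosed : ∀ a ∈ B, ∀ b, (openGraph ends (blue ζ')).Adj a b → b ∈ B := by
        intro a ha b hab
        obtain ⟨_, e, he, hends⟩ := exists_edge_of_adj hab
        by_contra hb
        have hw : e ∉ within ends B := fun hw => hb (endpoints_of_within ends hends hw).2
        have heq : ζ' e = ζ e := by simp [hζ', hw]
        rw [blue_apply, heq] at he
        have hred : ζ e = true := by
          rw [← hBζ] at ha hb
          exact red_of_mem_cluster_blue_of_notMem' ends ha hb hends
        rw [hred] at he
        exact Bool.false_ne_true he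
      intro u hu
      exact mem_of_conn_of_closed hclosed (v := l) hlB hu
    · calc B = cluster ends (blue ζ) l := hBζ.symm
        _ ⊆ cluster ends (blue ζ') l := cluster_mono hble l
  refine Finset.mem_image.2 ⟨ζ', ?_, ?_⟩
  · rw [mem_cls, mem_srcU_iff, ← hB]
    refine ⟨⟨?_, ?_, ?_⟩, hBζ', ?_⟩
    · intro hh
      rcases hh with hR | hBl
      · exact hhull (Or.inl (cluster_mono hle l hR))
      · rw [hBζ'] at hBl
        rw [← hBζ] at hBl
        exact hhull (Or.inr hBl)
    · rw [hBζ', ← hBζ]; exact hoB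
    · exact fun ho => hoR (cluster_mono hle l ho)
    · intro e he
      have hw : e ∉ within ends B := fun hw => he (within_subset_touches ends B hw)
      simp only [hζ', hw, if_false]
      exact hoff e he
  · ext e
    simp only [redW, Finset.mem_filter, Finset.mem_univ, true_and, hζ']
    constructor
    · rintro ⟨hw, he⟩
      simp only [hw, if_true] at he
      exact of_decide_eq_true he
    · intro he
      have hw : e ∈ within ends B := by
        have := hc' he
        simp only [redW, Finset.mem_filter, Finset.mem_univ, true_and] at this
        exact this.1
      exact ⟨hw, by simp [hw, he]⟩

end Class

end LocRows

end Summit.Ventures.PercRepro2
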